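import Summits.CriticalPhenomena.PercolationContinuityZ3.Theorems.PercNearOneGluingAdditiveGluingAL5Upsets
import HarnessLib

/-! # Crux `PercNearOneGluing.AdditiveGluing` (stmt-CriticalPhenomena-4576) — AL5 for EVERY block and EVERY relay set
# (part E: gluing the block star, the general theorem, and the registered rungs `stub_al5Rung2_dp`, `stub_al5Rung3_dp`)

Support file (`--supports stmt-CriticalPhenomena-4576`; task png-dp-al5, gen 2); no definitions, no named facts.  Notation of
`…AL5Layers.lean`: `μ_w = prodBernoulli w`, target `b`, bystander `x`, block `S` glued by `w^S := fun e => if e ∈ S.image (s(x,·))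
then 1 else w e`, relay neighbours `T` (star `F = T.image (s(x,·))`), `R = {ω | ∃ a ∈ T, s(x,a) ∈ ω}`.

**Theorem (`al5_general`, the lead's "averaged Lemma 5" AL5 / `X1 ≥ 0` in full generality).**  For every block `S` (`x ∉ S`),
every relay set `T` (`x ∉ T`, `S ∩ T = ∅`) and all `d, b`: if `μ_w(d↔b) ≤ μ_w(a↔b)` for every `a ∈ T` (hypothesis in the UN-glued
weighting), then `μ_{w^S}(R ∩ {d↔b}) ≤ μ_{w^S}(R ∩ {x↔b})`.  No restriction on `|S|`, `|T|`, the weights of the block star, or the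
other neighbours of `x`.  The registered rungs `stub_al5Rung2_dp` (`|S| ≤ 1`) and `stub_al5Rung3_dp` (`|S| ≤ 2`) are the verbatim
special cases.

**Proof.**  (1) `al5u_upsets_of_hyp` (part D): the hypothesis gives ALL up-set inequalities of the relay star in `w`.
(2) `al5u_upsets_glue_edge` / `al5u_upsets_glue_star`: gluing a pair `s(x,y)` (`y ∉ T`) preserves the family of up-set
inequalities — the transfer step `al5u_transfer` (part C) with `𝒰₀ = ∅`, `p = 1`: quantitative transfer (`knLemma3i_signed`),
BHK-monotone transfer factor, layer cake; induct over the block star.  (3) In `w^S` the up-set "all nonempty patterns" is the AL5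
margin (pattern expansion `al5u_sum_nonempty_eq`).
[cite: KozmaNitzan2024, Lemma 3(i) (pp. 6–7), Lemma 5 (p. 13), §3.1; VandenbergHaggstromKahn2005, Thms. 1.3–1.4 (pp. 6–7)]
-/

namespace Summit.CriticalPhenomena.PercolationContinuityZ3.Theorems

open MeasureTheory Set
open Literature.Probability.LatticeModels (prodBernoulli)
open Literature.Probability.Percolation (BondConfig openConn openGraph openEdgeCluster pinW localCylinder
  DeterminedBy determinedBy_iff)

noncomputable section
open Classical

section AL5AllRelays

open Filter Topology Literature.Probability.LatticeModels Literature.Probability.Percolation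

variable {n : ℕ}

/-- **Gluing one pair at the bystander preserves the up-set inequalities of the relay star** (`y ≠ x`, `s(x,y) ∉ F`, `d ≠ x`):
UPS(`u`, `F`) ⟹ UPS(`u[s(x,y) ↦ 1]`, `F`).  (`al5u_transfer` with `𝒰₀ = ∅`, `p = 1`; the pattern weights do not change.)
[cite: KozmaNitzan2024, Lemma 3(i) (pp. 6–7); VandenbergHaggstromKahn2005, Thms. 1.3–1.4] -/
theorem al5u_upsets_glue_edge (u : Sym2 (Fin n) → unitInterval) (x y d b : Fin n) (F : Finset (Sym2 (Fin n)))
    (hF : ∀ e ∈ F, ∃ a, a ≠ x ∧ e = s(x, a)) (hyx : y ≠ x) (hyF : s(x, y) ∉ F) (hdx : d ≠ x)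
    (hUPS : ∀ 𝒰 : Finset (Finset (Sym2 (Fin n))), 𝒰 ⊆ F.powerset → (∀ J ∈ 𝒰, J.Nonempty) →
      (∀ J ∈ 𝒰, ∀ J', J ⊆ J' → J' ⊆ F → J' ∈ 𝒰) →
      0 ≤ ∑ J ∈ 𝒰, ((∏ e ∈ J, (u e : ℝ)) * ∏ e ∈ F \ J, (1 - (u e : ℝ))) *
        ((prodBernoulli (pinW u ↑F ↑J)).real (openConn x b) - (prodBernoulli (pinW u ↑F ↑J)).real (openConn d b))) :
    ∀ 𝒰 : Finset (Finset (Sym2 (Fin n))), 𝒰 ⊆ F.powerset → (∀ J ∈ 𝒰, J.Nonempty) →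
      (∀ J ∈ 𝒰, ∀ J', J ⊆ J' → J' ⊆ F → J' ∈ 𝒰) →
      0 ≤ ∑ J ∈ 𝒰, ((∏ e ∈ J, ((fun e' : Sym2 (Fin n) => if e' = s(x, y) then (1 : unitInterval) else u e') e : ℝ)) *
          ∏ e ∈ F \ J, (1 - ((fun e' : Sym2 (Fin n) => if e' = s(x, y) then (1 : unitInterval) else u e') e : ℝ))) *
        ((prodBernoulli (pinW (fun e' : Sym2 (Fin n) => if e' = s(x, y) then 1 else u e') ↑F ↑J)).real (openConn x b) -
          (prodBernoulli (pinW (fun e' : Sym2 (Fin n) => if e' = s(x, y) then 1 else u e') ↑F ↑J)).real (openConn d b)) := by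
  intro 𝒰 h𝒰F hne hup
  have key := al5u_transfer u x y d b F hF hyx hyF hdx hUPS ∅ 𝒰 (Finset.empty_subset _) h𝒰F hne
    (fun J hJ => absurd hJ (Finset.notMem_empty J)) hup 1 zero_le_one le_rfl
  rw [Finset.sum_empty, zero_add, one_mul, Finset.sdiff_empty] at key
  refine le_trans key (le_of_eq (Finset.sum_congr rfl fun J hJ => ?_))
  have hJF : J ⊆ F := Finset.mem_powerset.1 (h𝒰F hJ)
  have hwt : ∀ e ∈ F, ((fun e' : Sym2 (Fin n) => if e' = s(x, y) then (1 : unitInterval) else u e') e : ℝ) = (u e : ℝ) := by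
    intro e he
    have hne' : e ≠ s(x, y) := fun h => hyF (h ▸ he)
    simp only [hne', if_false]
  congr 1
  congr 1
  · exact Finset.prod_congr rfl fun e he => (hwt e (hJF he)).symm
  · exact Finset.prod_congr rfl fun e he => by rw [hwt e (Finset.mem_sdiff.1 he).1]

/-- **Gluing the whole block star preserves the up-set inequalities** (induction on `S`, one pair at a time).
[cite: KozmaNitzan2024, Lemma 5 (p. 13), §3.1; VandenbergHaggstromKahn2005, Thms. 1.3–1.4] -/
theorem al5u_upsets_glue_star (x d b : Fin n) (F : Finset (Sym2 (Fin n))) (hF : ∀ e ∈ F, ∃ a, a ≠ x ∧ e = s(x, a))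
    (hdx : d ≠ x) (S : Finset (Fin n)) :
    ∀ (u : Sym2 (Fin n) → unitInterval), (∀ y ∈ S, y ≠ x) → (∀ y ∈ S, s(x, y) ∉ F) →
      (∀ 𝒰 : Finset (Finset (Sym2 (Fin n))), 𝒰 ⊆ F.powerset → (∀ J ∈ 𝒰, J.Nonempty) →
        (∀ J ∈ 𝒰, ∀ J', J ⊆ J' → J' ⊆ F → J' ∈ 𝒰) →
        0 ≤ ∑ J ∈ 𝒰, ((∏ e ∈ J, (u e : ℝ)) * ∏ e ∈ F \ J, (1 - (u e : ℝ))) *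
          ((prodBernoulli (pinW u ↑F ↑J)).real (openConn x b) - (prodBernoulli (pinW u ↑F ↑J)).real (openConn d b))) →
      ∀ 𝒰 : Finset (Finset (Sym2 (Fin n))), 𝒰 ⊆ F.powerset → (∀ J ∈ 𝒰, J.Nonempty) →
        (∀ J ∈ 𝒰, ∀ J', J ⊆ J' → J' ⊆ F → J' ∈ 𝒰) →
        0 ≤ ∑ J ∈ 𝒰, ((∏ e ∈ J, ((fun e' : Sym2 (Fin n) => if e' ∈ S.image (fun y => s(x, y)) then (1 : unitInterval) else u e') e : ℝ)) *
            ∏ e ∈ F \ J, (1 - ((fun e' : Sym2 (Fin n) => if e' ∈ S.image (fun y => s(x, y)) then (1 : unitInterval) else u e') e : ℝ))) *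
          ((prodBernoulli (pinW (fun e' : Sym2 (Fin n) => if e' ∈ S.image (fun y => s(x, y)) then 1 else u e') ↑F ↑J)).real
              (openConn x b) -
            (prodBernoulli (pinW (fun e' : Sym2 (Fin n) => if e' ∈ S.image (fun y => s(x, y)) then 1 else u e') ↑F ↑J)).real
              (openConn d b)) := by
  induction S using Finset.induction_on with
  | empty =>
    intro u _ _ hUPS
    have hu : (fun e' : Sym2 (Fin n) => if e' ∈ (∅ : Finset (Fin n)).image (fun y => s(x, y)) then (1 : unitInterval) else u e') = u := by
      funext e'
      simp only [Finset.image_empty, Finset.notMem_empty, if_false]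
    rw [hu]
    exact hUPS
  | insert y S hyS ih =>
    intro u hS hSF hUPS
    have hyx : y ≠ x := hS y (Finset.mem_insert_self y S)
    have hS' : ∀ y' ∈ S, y' ≠ x := fun y' hy' => hS y' (Finset.mem_insert_of_mem hy')
    have hSF' : ∀ y' ∈ S, s(x, y') ∉ F := fun y' hy' => hSF y' (Finset.mem_insert_of_mem hy')
    have h1 := ih u hS' hSF' hUPS
    have h2 := al5u_upsets_glue_edge (fun e' : Sym2 (Fin n) => if e' ∈ S.image (fun y => s(x, y)) then 1 else u e')
      x y d b F hF hyx (hSF y (Finset.mem_insert_self y S)) hdx h1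
    have hw : (fun e' : Sym2 (Fin n) => if e' ∈ (insert y S).image (fun y => s(x, y)) then (1 : unitInterval) else u e') =
        fun e' : Sym2 (Fin n) => if e' = s(x, y) then 1 else
          (if e' ∈ S.image (fun y => s(x, y)) then 1 else u e') := by
      funext e'
      rw [Finset.image_insert]
      by_cases he : e' = s(x, y)
      · subst he
        simp only [Finset.mem_insert_self, if_true]
      · simp only [Finset.mem_insert, he, false_or, if_false]
    rw [hw]
    exact h2

/-- **AL5 for every block and every relay set** (see the module docstring): block `S` with `x ∉ S`, relays `T` with `x ∉ T` and
`S ∩ T = ∅`; if `μ_w(d↔b) ≤ μ_w(a↔b)` for all `a ∈ T` (un-glued), then `μ_{w^S}(R ∩ {d↔b}) ≤ μ_{w^S}(R ∩ {x↔b})` (glued).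
[cite: KozmaNitzan2024, Lemma 3(i) (pp. 6–7), Lemma 5 (p. 13), §3.1; VandenbergHaggstromKahn2005, Thms. 1.3–1.4 (pp. 6–7)] -/
theorem al5_general (w : Sym2 (Fin n) → unitInterval) (S T : Finset (Fin n)) (x d b : Fin n)
    (hS : ∀ y ∈ S, y ≠ x) (hxT : x ∉ T) (hST : Disjoint S T)
    (hyp : ∀ a ∈ T, (prodBernoulli w).real (openConn d b) ≤ (prodBernoulli w).real (openConn a b)) :
    (prodBernoulli (fun e : Sym2 (Fin n) => if e ∈ S.image (fun y => s(x, y)) then 1 else w e)).real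
        ({ω : Set (Sym2 (Fin n)) | ∃ a ∈ T, s(x, a) ∈ ω} ∩ openConn d b) ≤
      (prodBernoulli (fun e : Sym2 (Fin n) => if e ∈ S.image (fun y => s(x, y)) then 1 else w e)).real
        ({ω : Set (Sym2 (Fin n)) | ∃ a ∈ T, s(x, a) ∈ ω} ∩ openConn x b) := by
  by_cases hdx : d = x
  · subst hdx
    exact le_rfl
  set F : Finset (Sym2 (Fin n)) := T.image (fun y => s(x, y)) with hFdef
  set gS : Sym2 (Fin n) → unitInterval := fun e => if e ∈ S.image (fun y => s(x, y)) then 1 else w e with hgS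
  have hF : ∀ e ∈ F, ∃ a, a ≠ x ∧ e = s(x, a) := by
    intro e he
    obtain ⟨a, haT, rfl⟩ := Finset.mem_image.1 he
    exact ⟨a, fun h => hxT (h ▸ haT), rfl⟩
  have hSF : ∀ y ∈ S, s(x, y) ∉ F := by
    intro y hyS hyF
    obtain ⟨a, haT, ha⟩ := Finset.mem_image.1 hyF
    rcases Sym2.eq_iff.1 ha with ⟨-, h2⟩ | ⟨h1, -⟩
    · exact Finset.disjoint_left.1 hST hyS (h2 ▸ haT)
    · exact hS y hyS h1.symm
  have hyp' : ∀ a : Fin n, a ≠ x → s(x, a) ∈ F →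
      (prodBernoulli w).real (openConn d b) ≤ (prodBernoulli w).real (openConn a b) := by
    intro a hax ha
    obtain ⟨a', ha'T, ha'⟩ := Finset.mem_image.1 ha
    rcases Sym2.eq_iff.1 ha' with ⟨-, h2⟩ | ⟨h1, h2⟩
    · exact h2 ▸ hyp a' ha'T
    · exact absurd h1.symm hax
  have hU := al5u_upsets_of_hyp w x d b hdx F hF hyp'
  have hUS := al5u_upsets_glue_star x d b F hF hdx S w hS hSF hU
  -- the up-set of all nonempty patterns
  have hpos := hUS (F.powerset.filter (fun J => J.Nonempty)) (Finset.filter_subset _ _)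
    (fun J hJ => (Finset.mem_filter.1 hJ).2)
    (fun J hJ J' hJJ' hJ'F => Finset.mem_filter.2 ⟨Finset.mem_powerset.2 hJ'F, (Finset.mem_filter.1 hJ).2.mono hJJ'⟩)
  rw [al5u_sum_nonempty_eq gS x d b F, sub_nonneg] at hpos
  have hR : {ω : Set (Sym2 (Fin n)) | ∃ a ∈ T, s(x, a) ∈ ω} = {ω | ∃ e ∈ F, e ∈ ω} := by
    ext ω
    simp only [Set.mem_setOf_eq, hFdef, Finset.mem_image]
    constructor
    · rintro ⟨a, haT, ha⟩; exact ⟨s(x, a), ⟨a, haT, rfl⟩, ha⟩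
    · rintro ⟨e, ⟨a, haT, rfl⟩, he⟩; exact ⟨a, haT, he⟩
  rw [hR]
  exact hpos

/-- Registered rung `stub_al5Rung2_dp` of crux stmt-CriticalPhenomena-4576 (task png-dp-al5): AL5 for blocks of size `≤ 2`
(bystander `x` plus `|S| ≤ 1` glued vertex), EVERY relay set `T` — verbatim registered signature, a special case of `al5_general`.
[cite: KozmaNitzan2024, Lemma 3(i) (pp. 6–7), Lemma 5 (p. 13)] -/
theorem stub_al5Rung2_dp : ∀ (n : ℕ) (w : Sym2 (Fin n) → unitInterval) (S T : Finset (Fin n)) (x d b : Fin n), S.card ≤ 1 → (∀ y ∈ S, y ≠ x) → x ∉ T → Disjoint S T → (∀ a ∈ T, (Literature.Probability.LatticeModels.prodBernoulli w).real (Literature.Probability.Percolation.openConn d b) ≤ (Literature.Probability.LatticeModels.prodBernoulli w).real (Literature.Probability.Percolation.openConn a b)) → (Literature.Probability.LatticeModels.prodBernoulli (fun e : Sym2 (Fin n) => if e ∈ S.image (fun y => s(x, y)) then 1 else w e)).real ({ω : Set (Sym2 (Fin n)) | ∃ a ∈ T, s(x, a) ∈ ω} ∩ Literature.Probability.Percolation.openConn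 d b) ≤ (Literature.Probability.LatticeModels.prodBernoulli (fun e : Sym2 (Fin n) => if e ∈ S.image (fun y => s(x, y)) then 1 else w e)).real ({ω : Set (Sym2 (Fin n)) | ∃ a ∈ T, s(x, a) ∈ ω} ∩ Literature.Probability.Percolation.openConn x b) := by
  intro n w S T x d b _ hS hxT hST hyp
  exact al5_general w S T x d b hS hxT hST hyp

/-- Registered rung `stub_al5Rung3_dp` of crux stmt-CriticalPhenomena-4576 (task png-dp-al5): AL5 for blocks of size `≤ 3`
(bystander `x` plus `|S| ≤ 2` glued vertices), EVERY relay set `T` — verbatim registered signature, a special case of `al5_general`.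
[cite: KozmaNitzan2024, Lemma 3(i) (pp. 6–7), Lemma 5 (p. 13)] -/
theorem stub_al5Rung3_dp : ∀ (n : ℕ) (w : Sym2 (Fin n) → unitInterval) (S T : Finset (Fin n)) (x d b : Fin n), S.card ≤ 2 → (∀ y ∈ S, y ≠ x) → x ∉ T → Disjoint S T → (∀ a ∈ T, (Literature.Probability.LatticeModels.prodBernoulli w).real (Literature.Probability.Percolation.openConn d b) ≤ (Literature.Probability.LatticeModels.prodBernoulli w).real (Literature.Probability.Percolation.openConn a b)) → (Literature.Probability.LatticeModels.prodBernoulli (fun e : Sym2 (Fin n) => if e ∈ S.image (fun y => s(x, y)) then 1 else w e)).real ({ω : Set (Sym2 (Fin n)) | ∃ a ∈ T, s(x, a) ∈ ω} ∩ Literature.Probability.Percolation.openConn d b) ≤ (Literature.Probability.LatticeModels.prodBernoulli (fun e : Sym2 (Fin n) => if e ∈ S.image (fun y => s(x, y)) then 1 else w e)).real ({ω : Set (Sym2 (Fin n)) | ∃ a ∈ T, s(x, a) ∈ ω} ∩ Literature.Probability.Percolation.openConn x b) := by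
  intro n w S T x d b _ hS hxT hST hyp
  exact al5_general w S T x d b hS hxT hST hyp

end AL5AllRelays

end

end Summit.CriticalPhenomena.PercolationContinuityZ3.Theorems
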